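import Literature.IUT.HodgeArakelov.AbsTopMonoidsGenuineGhatTopology
import Literature.IUT.HodgeArakelov.GaloisPairRigidityRmk1111cGenuine
import HarnessLib

/-!
# [IUTchII] Remark 1.11.1 (i) (c) for the TOPOLOGICAL pair `G ↷ O^ĝp(G)` at the GENUINE `(∗ĝp)`: the actions are
# continuous, every abstract pair automorphism is a homeomorphism, and `Aut_top(G ↷ O^ĝp(G)) ↠ Aut(G)` has kernel `Ẑ^×`

S. Mochizuki, *Inter-universal Teichmüller theory II*, §1, kurims manuscript (Dec. 2020): Example 1.8 (vii) p. 40 ("`(∗ĝp)`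
… inductive limits of profinite completions … `(G ↷ O^ĝp(G))` … compatible with a natural action of `Γ` on the underlying
ind-topological modules") and Remark 1.11.1 (i) (c) p. 50 ("the group of automorphisms of the underlying ind-topological
module equipped with a topological group action of `G ↷ O^ĝp(G)` maps surjectively [i.e., by forgetting `O^ĝp(G)`] onto the
group of automorphisms of the topological group `G`, with kernel given by the [`G`-linear] automorphisms … determined by the
natural action of `Ẑ^×`") [claim: Mochizuki2012, status: disputed] (IUTchII §1 Rmk 1.11.1 (i), kurims p.50).
abc-iut cell, layer L6, row «GHATGP-TOPOLOGY» (abc-iut-L6-lead gen 5 GO §F v1.19ay (1), 2026-08-26T16:25:36Z), PROOF-ONLY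
sequel 2/3 of `AbsTopMonoidsGenuineGhatTopology.lean` (the ind-topology); seat abc-iut-L6-d2 (gen 7).  Nodes
IUTchII:Rmk1.11.1(i) (clause (c)) and IUTchII:Rmk1.11.3(ii) (clause (η), `O^ĝp`-half): the modelling disclosure
«ind-topologies NOT modelled» of the gen-6 closer `AbsTopMonoids.rmk1111_c_genuineGhat` (p452340) is REMOVED:

* (a) CONTINUITY: `PowCompletion.continuous_map` / `continuous_zhatPow` (componentwise maps of `lim_n A/Aⁿ` have locally
  constant components); on `O^ĝp = lim→_J ((k̄^×)^J)^∧` with its colimit topology — `continuous_zhatPowOghat` (the natural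
  `Ẑ^×`-action), `continuous_transportOghat(Equiv)(_symm)` (transports along equivariant automorphisms of `k̄^×`),
  `continuous_galActOghat` (the `G_k`-action) and, at the all-fields-genuine producer `genuineOfModelIsm S C ε hΔ hq`,
  `AbsTopMonoids.continuous_genuineGhatAct` (the `G`-action on `O^ĝp(G)`; every `g` acts by a homeomorphism).
* (b) AUTOMATIC CONTINUITY `AbsTopMonoids.genuineGhat_topPairAut_eq_pairAut`: EVERY abstract automorphism `(σ, ψ)` of the pair
  `G ↷ O^ĝp(G)` (abc-iut-L6-t1's `PairAut`) has `ψ` a homeomorphism — `ψ` is the continuous transport pair over `σ`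
  (`genuineGhat_liftPair_mem`, the lift of `genuineGhat_forget_surjective` p445174 made explicit) times an element of the
  kernel, which is a `Ẑ^×`-power by the gen-6 kernel clause `genuineGhat_kernel` (p452340), hence continuous.  So the group of
  automorphisms of the TOPOLOGICAL pair (`TopPairAut`, the def file) coincides with the abstract one, and print's clause (c)
  for the topological pair follows verbatim from `rmk1111_c_genuineGhat`: `genuineGhat_topForget_surjective`,
  `genuineGhat_topKernel`, `genuineGhat_zhatPow_mem_topPairAut`, packaged as **`AbsTopMonoids.rmk1111_c_topological_genuineGhat`**
  (the three clauses of abc-iut-L6-t1's schema `Rmk1111_c`, with `PairAut` replaced by `TopPairAut`).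

HONEST FRAMING: classical topology / algebra over OUR typed objects, every input PROVED in the tree; the profiniteness of
the levels and the JOINT continuity of `G_k × O^ĝp → O^ĝp` are in the sequel `AbsTopMonoidsGenuineGhatTopologyProofs.lean`;
record-anchored to a disputed corpus through the locators only; nothing here bears on [IUTchIII] Cor. 3.12; typed ≠ proved
elsewhere.
-/

set_option autoImplicit false

noncomputable section

namespace Literature.IUT.HodgeArakelov

open CategoryTheory Topology
open Literature.AnabelianGeometry.AbsoluteAnabelian

universe u

/-! ## (a) Continuity at the levels `Â = lim_n A/Aⁿ` -/

namespace PowCompletion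

variable {A B : Type u} [CommGroup A] [CommGroup B]

/-- `φ̂ : Â → B̂` is continuous (its `n`-th component is `φ_n ∘ (n`-th component)). [cite: NeukirchANT1999, Ch. IV §2 p.274] -/
theorem continuous_map (φ : A →* B) : Continuous (map φ) :=
  continuous_of_isLocallyConstant fun n => (isLocallyConstant_component n).comp (mapLevel φ n)

/-- The `Ẑ^×`-action `x ↦ x^u` on `Â` is continuous (its `n`-th component is `(·)^{χ_n(u)} ∘ (n`-th component)).
[cite: NeukirchANT1999, Ch. IV §2 p.274] -/
theorem continuous_zhatPow (u : ZHatUnits) : Continuous (zhatPow A u) :=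
  continuous_of_isLocallyConstant fun n =>
    (isLocallyConstant_component n).comp fun c => c ^ AbsTopMonoids.Genuine.levelExp u n

end PowCompletion

/-! ## (a) Continuity on `O^ĝp = lim→_J ((k̄^×)^J)^∧` (colimit topology) -/

namespace AbsTopMonoids.Genuine

variable (C : MLFClosure.{0})

/-- **The natural `Ẑ^×`-action on `O^ĝp` is continuous** (levelwise `x ↦ x^u`). [claim: Mochizuki2012, status: disputed] (IUTchII §1 Ex 1.8 (vii), kurims p.40) -/
theorem continuous_zhatPowOghat (u : ZHatUnits) : Continuous (zhatPowOghat C u) :=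
  continuous_of_levelwise C id (fun _ => PowCompletion.zhatPow _ u) (fun _ => PowCompletion.continuous_zhatPow u)
    (fun _ _ => rfl)

/-- The inverse of `x ↦ x^u` is `x ↦ x^{u⁻¹}`, hence continuous: `u` acts by a HOMEOMORPHISM.
[claim: Mochizuki2012, status: disputed] (IUTchII §1 Ex 1.8 (vii), kurims p.40) -/
theorem continuous_zhatPowOghat_symm (u : ZHatUnits) : Continuous (zhatPowOghat C u).symm := by
  have h : (zhatPowOghat C u).symm = zhatPowOghat C u⁻¹ := (map_inv (zhatPowOghat C) u).symm
  rw [h]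
  exact continuous_zhatPowOghat C u⁻¹

section Transport

variable (φ : (C.K ≃ₐ[C.k] C.K) ≃ₜ* (C.K ≃ₐ[C.k] C.K)) (τ : (C.K)ˣ ≃* (C.K)ˣ) (hτ : IsEquivariantUnits C φ τ)

/-- The transport `τ̂ : O^ĝp → O^ĝp` along a `φ`-equivariant automorphism `τ` of `k̄^×` is continuous (levelwise
`PowCompletion.map`, level `J ↦ φ(J)`). [claim: Mochizuki2012, status: disputed] (IUTchII §1 Ex 1.8 (vii), kurims p.40) -/
theorem continuous_transportOghat : Continuous (transportOghat C φ τ hτ) :=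
  continuous_of_levelwise C (GhatLevel.transport C φ) (fun i => PowCompletion.map (levelTau C φ τ hτ i))
    (fun _ => PowCompletion.continuous_map _) (fun _ _ => rfl)

end Transport

/-- The transport AUTOMORPHISM is continuous. [claim: Mochizuki2012, status: disputed] (IUTchII §1 Ex 1.8 (vii), kurims p.40) -/
theorem continuous_transportOghatEquiv {φ : (C.K ≃ₐ[C.k] C.K) ≃ₜ* (C.K ≃ₐ[C.k] C.K)} {τ : (C.K)ˣ ≃* (C.K)ˣ}
    (h : IsEquivariantUnits C φ τ) : Continuous (transportOghatEquiv C h) :=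
  continuous_transportOghat C φ τ h

/-- … and so is its inverse (the transport along `(φ⁻¹, τ⁻¹)`): transports act by HOMEOMORPHISMS.
[claim: Mochizuki2012, status: disputed] (IUTchII §1 Ex 1.8 (vii), kurims p.40) -/
theorem continuous_transportOghatEquiv_symm {φ : (C.K ≃ₐ[C.k] C.K) ≃ₜ* (C.K ≃ₐ[C.k] C.K)} {τ : (C.K)ˣ ≃* (C.K)ˣ}
    (h : IsEquivariantUnits C φ τ) : Continuous (transportOghatEquiv C h).symm :=
  (continuous_transportOghat C φ.symm τ.symm h.symm).congr fun _ => rfl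

/-- **The `G_k`-action on `O^ĝp(G_k)` is by homeomorphisms**: each `σ̂` is continuous.
[claim: Mochizuki2012, status: disputed] (IUTchII §1 Ex 1.8 (vii), kurims p.40) -/
theorem continuous_galActOghat (σ : C.K ≃ₐ[C.k] C.K) : Continuous (galActOghat C σ) :=
  continuous_transportOghatEquiv C (isEquivariantUnits_gal C σ)

/-- `continuous_galActOghat_symm` (structure lemma of the genuine `(∗ĝp)` topology). [claim: Mochizuki2012, status: disputed] (IUTchII §1 Ex 1.8 (vii), kurims p.40) -/
theorem continuous_galActOghat_symm (σ : C.K ≃ₐ[C.k] C.K) : Continuous (galActOghat C σ).symm :=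
  continuous_transportOghatEquiv_symm C (isEquivariantUnits_gal C σ)

end AbsTopMonoids.Genuine

/-! ## (a)/(b) At the all-fields-genuine producer: the topological pair `G ↷ O^ĝp(G)` -/

section Genuine

open AbsTopMonoids AbsTopMonoids.Genuine

variable (S : ThetaSetting.{0}) (C : MLFClosure.{0}) (ε : S.Gk ≃ₜ* (ModelMLFGaloisData.galois C.k C.K).tmPair.Pi)
  (hΔ : ∀ f : S.PiX ≃ₜ* S.PiX, S.DeltaX.map f.toMulEquiv.toMonoidHom = S.DeltaX)
  (hq : Nonempty (TopGroup.quot S.PiX S.DeltaX ≃ₜ* S.Gk))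

/-- **The `G`-action on `O^ĝp(G)` at the genuine `(∗ĝp)` is by homeomorphisms**: every `g ∈ G` acts continuously
("topological group action" of print). [claim: Mochizuki2012, status: disputed] (IUTchII §1 Ex 1.8 (vii), kurims p.40) -/
theorem AbsTopMonoids.continuous_genuineGhatAct (G : IsoClass S.Gk) (g : G.G) :
    Continuous (AbsTopMonoids.genuineGhatAct S C ε G g) :=
  continuous_galActOghat C (theta C ε G g)

/-- `AbsTopMonoids.continuous_genuineGhatAct_symm` (structure lemma of the genuine `(∗ĝp)` topology). [claim: Mochizuki2012, status: disputed] (IUTchII §1 Ex 1.8 (vii), kurims p.40) -/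
theorem AbsTopMonoids.continuous_genuineGhatAct_symm (G : IsoClass S.Gk) (g : G.G) :
    Continuous (AbsTopMonoids.genuineGhatAct S C ε G g).symm :=
  continuous_galActOghat_symm C (theta C ε G g)

/-- The `Γ = Ẑ^×`-action carried by the genuine `ProfiniteGroupifications` datum IS `zhatPowOghat` (definitionally); its
continuity is `continuous_zhatPowOghat`. [claim: Mochizuki2012, status: disputed] (IUTchII §1 Ex 1.8 (vii), kurims p.40) -/
theorem AbsTopMonoids.genuineGhat_actΓO (G : IsoClass S.Gk) :
    (AbsTopMonoids.genuineGhat S C ε hΔ hq).actΓO G = zhatPowOghat C := rfl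

/-- **The explicit lift of `σ ∈ Aut(G)`** to a pair automorphism of `G ↷ O^ĝp(G)`: `(σ, (liftM(φ_σ)^gp)^)` — the transport
along the groupified equivariant lift — IS a pair automorphism (the witness inside abc-iut-L6-d2 gen 6's
`genuineGhat_forget_surjective`, p445174, made explicit). [claim: Mochizuki2012, status: disputed] (IUTchII §1 Rmk 1.11.1 (i), kurims p.50) -/
theorem AbsTopMonoids.genuineGhat_liftPair_mem (G : IsoClass S.Gk) (σ : Aut G) :
    (σ, transportOghatEquiv C (isEquivariantUnits_liftUnits C (phiOf C ε σ.hom))) ∈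
      PairAut G (Genuine.Oghat C) (AbsTopMonoids.genuineGhatAct S C ε G) := by
  intro g m
  let φ := phiOf C ε σ.hom
  have hτ := isEquivariantUnits_liftUnits C φ
  let t : C.K ≃ₐ[C.k] C.K := theta C ε G g
  change transportOghat C φ (liftUnits C φ) hτ (galActOghat C t m) =
    galActOghat C (theta C ε G (IsoClass.homIso σ.hom g)) (transportOghat C φ (liftUnits C φ) hτ m)
  have hφg : theta C ε G (IsoClass.homIso σ.hom g) = φ t := by
    change _ = theta C ε G (IsoClass.homIso σ.hom ((theta C ε G).symm (theta C ε G g)))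
    rw [ContinuousMulEquiv.symm_apply_apply]
  rw [hφg, galActOghat_apply, galActOghat_apply,
    ← transportOghat_comp_apply C (isEquivariantUnits_gal C t) hτ
      ((isEquivariantUnits_gal C t).trans C hτ) (fun _ => rfl) (fun _ => rfl) m,
    ← transportOghat_comp_apply C hτ (isEquivariantUnits_gal C (φ t))
      ((isEquivariantUnits_gal C t).trans C hτ) ?_ ?_ m]
  · intro γ
    have key : ∀ a b : (ModelMLFGaloisData.galois C.k C.K).tmPair.Pi, φ (a * b * a⁻¹) = φ a * φ b * (φ a)⁻¹ :=
      fun a b => by rw [map_mul, map_mul, map_inv]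
    exact key t γ
  · intro x
    exact hτ t x

include hΔ hq in
/-- **AUTOMATIC CONTINUITY**: every abstract automorphism `(σ, ψ)` of the pair `G ↷ O^ĝp(G)` at the genuine `(∗ĝp)` has `ψ`
a HOMEOMORPHISM of the ind-topology — `ψ =` (the continuous transport over `σ`) `∘` (a `Ẑ^×`-power), by the kernel clause
of Remark 1.11.1 (i) (c) (`genuineGhat_kernel`, p452340). [claim: Mochizuki2012, status: disputed] (IUTchII §1 Rmk 1.11.1 (i), kurims p.50) -/
theorem AbsTopMonoids.genuineGhat_pairAut_continuous (G : IsoClass S.Gk)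
    (p : PairAut G (Genuine.Oghat C) (AbsTopMonoids.genuineGhatAct S C ε G)) :
    Continuous p.1.2 ∧ Continuous p.1.2.symm := by
  have hτ := isEquivariantUnits_liftUnits C (phiOf C ε p.1.1.hom)
  let p₀ : PairAut G (Genuine.Oghat C) (AbsTopMonoids.genuineGhatAct S C ε G) :=
    ⟨(p.1.1, transportOghatEquiv C hτ), AbsTopMonoids.genuineGhat_liftPair_mem S C ε G p.1.1⟩
  have h1 : PairAut.forget (p₀⁻¹ * p) = 1 := inv_mul_cancel p.1.1
  obtain ⟨u, hu⟩ := AbsTopMonoids.genuineGhat_kernel S C ε hΔ hq G (p₀⁻¹ * p) h1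
  have hp : p.1.2 = transportOghatEquiv C hτ * zhatPowOghat C u := by
    rw [← hu]
    exact (mul_inv_cancel_left (transportOghatEquiv C hτ) p.1.2).symm
  refine ⟨?_, ?_⟩
  · rw [hp]
    exact (continuous_transportOghatEquiv C hτ).comp (continuous_zhatPowOghat C u)
  · rw [hp]
    exact (continuous_zhatPowOghat_symm C u).comp (continuous_transportOghatEquiv_symm C hτ)

include hΔ hq in
/-- **The automorphism group of the TOPOLOGICAL pair `G ↷ O^ĝp(G)` coincides with that of the abstract pair** (at the genuine
`(∗ĝp)`): `TopPairAut = PairAut`. [claim: Mochizuki2012, status: disputed] (IUTchII §1 Rmk 1.11.1 (i), kurims p.50) -/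
theorem AbsTopMonoids.genuineGhat_topPairAut_eq_pairAut (G : IsoClass S.Gk) :
    TopPairAut G (Genuine.Oghat C) (AbsTopMonoids.genuineGhatAct S C ε G) =
      PairAut G (Genuine.Oghat C) (AbsTopMonoids.genuineGhatAct S C ε G) :=
  le_antisymm (topPairAut_le_pairAut G _ _) fun p hp =>
    ⟨hp, AbsTopMonoids.genuineGhat_pairAut_continuous S C ε hΔ hq G ⟨p, hp⟩⟩

/-- **IUTchII:Rmk1.11.1(i) (c) for the TOPOLOGICAL pair, clause (1)**: `Aut_top(G ↷ O^ĝp(G)) → Aut(G)` is SURJECTIVE —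
`σ` lifts to the homeomorphic pair automorphism `(σ, (liftM(φ_σ)^gp)^)`. [claim: Mochizuki2012, status: disputed] (IUTchII §1 Rmk 1.11.1 (i), kurims p.50) -/
theorem AbsTopMonoids.genuineGhat_topForget_surjective (G : IsoClass S.Gk) :
    Function.Surjective (TopPairAut.forget (G := G) (M := Genuine.Oghat C) (act := AbsTopMonoids.genuineGhatAct S C ε G)) :=
  fun σ => ⟨⟨(σ, transportOghatEquiv C (isEquivariantUnits_liftUnits C (phiOf C ε σ.hom))),
    AbsTopMonoids.genuineGhat_liftPair_mem S C ε G σ, continuous_transportOghatEquiv C _,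
    continuous_transportOghatEquiv_symm C _⟩, rfl⟩

include hΔ hq in
/-- **IUTchII:Rmk1.11.1(i) (c) for the TOPOLOGICAL pair, clause (2)**: an automorphism of the topological pair over
`1 ∈ Aut(G)` is a `Ẑ^×`-power. [claim: Mochizuki2012, status: disputed] (IUTchII §1 Rmk 1.11.1 (i), kurims p.50) -/
theorem AbsTopMonoids.genuineGhat_topKernel (G : IsoClass S.Gk)
    (p : TopPairAut G (Genuine.Oghat C) (AbsTopMonoids.genuineGhatAct S C ε G)) (hp : TopPairAut.forget p = 1) :
    ∃ u : ZHatUnits, p.1.2 = zhatPowOghat C u :=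
  AbsTopMonoids.genuineGhat_kernel S C ε hΔ hq G ⟨p.1, topPairAut_le_pairAut G (Genuine.Oghat C) _ p.2⟩ hp

include hΔ hq in
/-- **IUTchII:Rmk1.11.1(i) (c) for the TOPOLOGICAL pair, clause (3)**: every `Ẑ^×`-power is a (`G`-linear) automorphism
of the topological pair. [claim: Mochizuki2012, status: disputed] (IUTchII §1 Rmk 1.11.1 (i), kurims p.50) -/
theorem AbsTopMonoids.genuineGhat_zhatPow_mem_topPairAut (G : IsoClass S.Gk) (u : ZHatUnits) :
    ((1 : Aut G), zhatPowOghat C u) ∈ TopPairAut G (Genuine.Oghat C) (AbsTopMonoids.genuineGhatAct S C ε G) :=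
  ⟨AbsTopMonoids.genuineGhat_zhatPow_mem_pairAut S C ε hΔ hq G u, continuous_zhatPowOghat C u,
    continuous_zhatPowOghat_symm C u⟩

include hΔ hq in
/-- **IUTchII:Rmk1.11.1(i) (c) HOLDS FOR THE TOPOLOGICAL PAIR `G ↷ O^ĝp(G)` at the genuine `(∗ĝp)`** (print's statement
verbatim: "the group of automorphisms of the underlying ind-topological module equipped with a topological group action of
`G ↷ O^ĝp(G)` maps surjectively … onto … `Aut(G)`, with kernel … the natural action of `Ẑ^×`") — the three clauses of
abc-iut-L6-t1's schema `Rmk1111_c` with `PairAut` replaced by `TopPairAut`; a COROLLARY of the (stronger, abstract)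
`rmk1111_c_genuineGhat` (p452340) and automatic continuity. [claim: Mochizuki2012, status: disputed] (IUTchII §1 Rmk 1.11.1 (i), kurims p.50) -/
theorem AbsTopMonoids.rmk1111_c_topological_genuineGhat (G : IsoClass S.Gk) :
    Function.Surjective
        (TopPairAut.forget (G := G) (M := Genuine.Oghat C) (act := AbsTopMonoids.genuineGhatAct S C ε G)) ∧
      (∀ p : TopPairAut G (Genuine.Oghat C) (AbsTopMonoids.genuineGhatAct S C ε G),
        TopPairAut.forget p = 1 → ∃ u : ZHatUnits, p.1.2 = zhatPowOghat C u) ∧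
      ∀ u : ZHatUnits,
        ((1 : Aut G), zhatPowOghat C u) ∈ TopPairAut G (Genuine.Oghat C) (AbsTopMonoids.genuineGhatAct S C ε G) :=
  ⟨AbsTopMonoids.genuineGhat_topForget_surjective S C ε G,
    fun p hp => AbsTopMonoids.genuineGhat_topKernel S C ε hΔ hq G p hp,
    fun u => AbsTopMonoids.genuineGhat_zhatPow_mem_topPairAut S C ε hΔ hq G u⟩

end Genuine

end Literature.IUT.HodgeArakelov

end
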